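import Literature.Geometry.Lorentzian.MinimalSurfaceBarrier
import Literature.Geometry.Lorentzian.SecondFundamentalFormApply
import HarnessLib

/-!
# The sides of a compact minimal boundary: transversality of the normal curves and the
# one-sided / two-sided dichotomy (family `gr`, in support of **gr.S09**; namespace
# `Literature.Geometry.Lorentzian`)

The exterior-region facts of `ExteriorRegion.lean`, `OutermostHorizon.lean`, `PenroseRigidity.lean`
(Huisken–Ilmanen, J. Differential Geom. 59 (2001), Lemma 4.1; Bray, J. Differential Geom. 59
(2001), Thm. 19) present a manifold with boundary as an open region `U` of the boundaryless data
manifold `X` with compact minimal topological boundary `∂U = range B.f` (`MinimalBoundary`). Along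
a component of `∂U` the region may lie on **one side** (the component is a boundary component of
the metric completion `M'` of `U`) or on **both sides** (it is *doubled* in `∂M'`, Huisken–Ilmanen,
proof of Lemma 4.1); the named fact `Bray2001_oneSided_of_penrose_eq` (`PenroseRigidity.lean`) and
the hypothesis `IsOutsideOf` of Bray's Thm. 9 (`MassCapacity.lean`, Def. 3: a surface of class `𝒮`
has an inside and an outside) speak about this through the chart-straight curves
`c_y = curveThrough (𝓡 3) (B.f y) (B.ν y)`: `U` is *two-sided at `y`* when `c_y t ∈ U` for small
`t < 0` (for small `t > 0` it is, `MinimalBoundary.pointsInto`), *one-sided* when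
`c_y t ∉ closure U` for small `t < 0`. This file **proves** the differential-topological
bookkeeping behind these clauses, which the docstrings of those files use in prose
("`U` lies on exactly one side of each component", "doubled components counted twice"):

* `hasDerivAt_sliceHeight_curveThrough`, `eventually_sliceHeight_curveThrough` — in a chart `ψ`
  of the maximal atlas straightened by `T : E3 ≃ ℝ² × ℝ`, the height `(T ∘ ψ).2` along the
  chart-straight curve through `p` with velocity `v` has derivative `(T (dψ_p v)).2` at `t = 0`
  (chain rule, with `hasMFDerivAt_curveThrough_zero` of `SecondFundamentalFormApply.lean`); if it
  is non-zero the curve lies on opposite sides of the slice `{(T ∘ ψ).2 = 0}` for small `t > 0`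
  and small `t < 0` (`eventually_mul_pos_and_mul_neg_of_hasDerivAt`);
* `snd_straighten_mfderiv_normal_ne_zero` — **a unit normal is transversal to the slice**: for a
  spacelike immersion `f` with unit normal `ν` taking values, inside an open `O ⊆ ψ.source`, in the
  slice, `(T (dψ (ν y))).2 ≠ 0` whenever `f y ∈ O` (the height vanishes along `f`, so its
  differential kills `range df_y`; `ν y ∉ range df_y` as `h(ν, df w) = 0 ≠ 1 = h(ν, ν)`; and
  `range df_y ⊕ ℝ ν y = T_{f y} X` by the dimension count `2 + 1 = 3`);
* `sides_of_eventually_mem` — the purely topological bookkeeping for an open `U`, two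
  preconnected "half-boxes" missing `frontier U` and a curve entering one for `t > 0` and the
  other for `t < 0`;
* `MinimalBoundary.sides_sliceBox` — **theorem**: in a slice box `(ψ, T, O)` of `range B.f`
  (`exists_sliceBox`, `MinimalSurfaceBarrier.lean`) at least one open half-box lies in `U`, `U` is
  two-sided at any `y` with `B.f y ∈ O` iff *both* half-boxes lie in `U`, and one-sided iff not;
* `MinimalBoundary.eventually_mem_or_eventually_notMem_closure` — **theorem**: at every `y`, `U`
  is two-sided or one-sided (and not both, `not_eventually_mem_of_eventually_notMem_closure`);
* `MinimalBoundary.isClopen_setOf_eventually_mem` — **theorem**: the two-sided locus is open and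
  closed in `B.surf`, so two-sidedness is all-or-nothing along each component of `∂U`.

These are glue steps for the exterior-region facts (e.g. the reduction of
`Bray2001_oneSided_of_penrose_eq` to an area inequality counting doubled components twice), not a
discharge of any of them; no definitions and no named facts are introduced.

## Mathlib

Used: `IsManifold.maximalAtlas` with `contMDiffOn_of_mem_maximalAtlas`/`contMDiffAt_of_mem_maximalAtlas`,
`OpenPartialHomeomorph.MDifferentiable.mfderiv` (the differential of a chart as a linear
isomorphism), `HasMFDerivAt.comp`, `hasMFDerivAt_unique`, `hasMFDerivAt_iff_hasFDerivAt`,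
`HasFDerivAt.hasDerivAt`, `HasDerivAt.tendsto_slope_zero`, `ContinuousLinearMap.hasMFDerivAt`,
`Submodule.finrank_sup_add_finrank_inf_eq`, `finrank_span_singleton`,
`LinearMap.finrank_range_of_inj`, `Submodule.eq_top_of_finrank_eq`, `finrank_euclideanSpace_fin`,
`IsPreconnected.subset_of_closure_inter_subset`, `Disjoint.closure_right`; and the tree's
`curveThrough`, `hasMFDerivAt_curveThrough_zero`, `exists_sliceBox`, `MinimalBoundary`,
`IsSpacelikeImmersion.injective_mfderiv`, `IsUnitNormal`.

## Design choices

* *Dimension `2 ⊂ 3` only*, the setting of `MinimalBoundary`; the statements about curves and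
  slices are for charts of `E3`-modelled manifolds (boundaryless, so every point is interior and
  `curveThrough` has the prescribed velocity).
* *Signs through `a · height`.* The side entered for `t > 0` depends on the sign of
  `a = (T (dψ (B.ν y))).2`, which varies with the slice box; the statements that matter
  (`sides_sliceBox` onwards) are sign-free.
* *No minimality is used*: everything holds for any `MinimalBoundary`-like datum (embedded compact
  surface with a transversal field pointing into `U`); it is stated for `MinimalBoundary` because
  that is the consumer.

## References

* G. Huisken, T. Ilmanen, *The inverse mean curvature flow and the Riemannian Penrose
  inequality*, J. Differential Geom. 59 (2001) 353–437: §4, Lemma 4.1 and its proof (exterior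
  region, metric completion, doubled boundary components).
* H. L. Bray, *Proof of the Riemannian Penrose inequality using the positive mass theorem*,
  J. Differential Geom. 59 (2001) 177–267: §2, Def. 3 (the class `𝒮`: inside and outside).
* J. M. Lee, *Introduction to Smooth Manifolds*, 2nd ed., Springer 2013, Thm. 5.8 and Prop. 5.2
  (slice charts of embedded submanifolds; tangent space of a slice).
* B. O'Neill, *Semi-Riemannian geometry with applications to relativity*, Academic Press 1983,
  Ch. 1, Lemma 15, Def. 17 and Exercise 5 (chain rule, velocity of a curve).
-/

noncomputable section

open Bundle Set Manifold TopologicalSpace Filter Function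
open scoped ContDiff Topology Manifold

namespace Literature.Geometry.Lorentzian

open PseudoRiemannianMetric

/-! ### An elementary sign lemma -/

/-- A real function vanishing at `0` with non-zero derivative `a` there satisfies `a · g > 0`
just to the right of `0` and `a · g < 0` just to the left (the difference quotient tends to `a`).
[folklore] -/
theorem eventually_mul_pos_and_mul_neg_of_hasDerivAt {g : ℝ → ℝ} {a : ℝ} (hg : HasDerivAt g a 0)
    (h0 : g 0 = 0) (ha : a ≠ 0) :
    (∀ᶠ t in 𝓝[>] (0 : ℝ), 0 < a * g t) ∧ (∀ᶠ t in 𝓝[<] (0 : ℝ), a * g t < 0) := by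
  have ht : Tendsto (fun t ↦ t⁻¹ • (g (0 + t) - g 0)) (𝓝[≠] 0) (𝓝 a) := hg.tendsto_slope_zero
  simp only [zero_add, h0, sub_zero, smul_eq_mul] at ht
  have hev : ∀ᶠ t in 𝓝[≠] (0 : ℝ), 0 < a * (t⁻¹ * g t) :=
    (ht.const_mul a).eventually (lt_mem_nhds (mul_self_pos.mpr ha))
  constructor
  · filter_upwards [hev.filter_mono (nhdsGT_le_nhdsNE 0), self_mem_nhdsWithin] with t h1 ht
    have ht' : 0 < t := ht
    have htne : t ≠ 0 := ht'.ne'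
    have : a * g t = t * (a * (t⁻¹ * g t)) := by field_simp
    rw [this]
    exact mul_pos ht' h1
  · filter_upwards [hev.filter_mono (nhdsLT_le_nhdsNE 0), self_mem_nhdsWithin] with t h1 ht
    have ht' : t < 0 := ht
    have htne : t ≠ 0 := ht'.ne
    have : a * g t = t * (a * (t⁻¹ * g t)) := by field_simp
    rw [this]
    exact mul_neg_of_neg_of_pos ht' h1

/-! ### The height of a slice chart along a chart-straight curve -/

section CurveThrough

variable {X : Type*} [TopologicalSpace X] [ChartedSpace E3 X] [IsManifold (𝓡 3) ∞ X]

/-- **Chain rule for the slice height along a chart-straight curve.** For a chart `ψ` of the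
maximal `C^∞` atlas of the (boundaryless) `3`-manifold `X`, a linear straightening
`T : E3 ≃ ℝ² × ℝ` and `p ∈ ψ.source`, the height `t ↦ (T (ψ (c t))).2` along the chart-straight
curve `c` through `p` with velocity `v` (`curveThrough`; derivative `t ↦ t • v` at `0`,
`hasMFDerivAt_curveThrough_zero`) has derivative `(T (dψ_p v)).2` at `t = 0`. O'Neill 1983, Ch. 1,
Lemma 15 and Def. 17 (4) (`dφ(α'(t)) = (φ ∘ α)'(t)`). [cite: ONeill1983, Ch. 1, Lemma 15 and Def. 17] -/
theorem hasDerivAt_sliceHeight_curveThrough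
    {ψ : OpenPartialHomeomorph X E3} (hψ : ψ ∈ IsManifold.maximalAtlas (𝓡 3) ∞ X)
    (T : E3 ≃L[ℝ] EuclideanSpace ℝ (Fin 2) × ℝ) {p : X} (hp : p ∈ ψ.source)
    (v : TangentSpace (𝓡 3) p) :
    HasDerivAt (fun t ↦ (T (ψ (curveThrough (𝓡 3) p v t))).2)
      (T (mfderiv (𝓡 3) (𝓡 3) ψ p v)).2 0 := by
  set c := curveThrough (𝓡 3) p v with hc
  have h1 : HasMFDerivAt 𝓘(ℝ, ℝ) (𝓡 3) c 0
      ((ContinuousLinearMap.id ℝ ℝ).smulRight (show E3 from v)) :=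
    hasMFDerivAt_curveThrough_zero (I := 𝓡 3) BoundarylessManifold.isInteriorPoint v
  have hc0 : c 0 = p := curveThrough_zero (𝓡 3) p v
  have hψd : MDifferentiableAt (𝓡 3) (𝓡 3) ψ p :=
    (contMDiffAt_of_mem_maximalAtlas hψ hp).mdifferentiableAt (by simp)
  set Λ : E3 →L[ℝ] ℝ :=
    (ContinuousLinearMap.snd ℝ (EuclideanSpace ℝ (Fin 2)) ℝ).comp (T : E3 →L[ℝ] _) with hΛ
  have h2 : HasMFDerivAt (𝓡 3) (𝓡 3) ψ (c 0) (mfderiv (𝓡 3) (𝓡 3) ψ p) := by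
    rw [hc0]; exact hψd.hasMFDerivAt
  have h3 : HasMFDerivAt (𝓡 3) 𝓘(ℝ, ℝ) (Λ : E3 → ℝ) (ψ (c 0)) Λ := Λ.hasMFDerivAt
  have h4 := (h3.comp (c 0) h2).comp 0 h1
  rw [hasMFDerivAt_iff_hasFDerivAt] at h4
  have h5 : HasFDerivAt ((Λ : E3 → ℝ) ∘ ψ ∘ c) ((Λ.comp (mfderiv (𝓡 3) (𝓡 3) ψ p)).comp
      ((ContinuousLinearMap.id ℝ ℝ).smulRight (show E3 from v))) 0 := h4
  have h6 : ((Λ.comp (mfderiv (𝓡 3) (𝓡 3) ψ p)).comp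
      ((ContinuousLinearMap.id ℝ ℝ).smulRight (show E3 from v))) (1 : ℝ) =
      (T (mfderiv (𝓡 3) (𝓡 3) ψ p v)).2 := by
    show Λ (mfderiv (𝓡 3) (𝓡 3) ψ p ((1 : ℝ) • v)) = _
    rw [one_smul]
    rfl
  exact h5.hasDerivAt.congr_deriv h6

/-- **Transversal chart-straight curves change side.** With `ψ`, `T` as above, `O` open inside
`ψ.source`, `p ∈ O` on the slice `{(T ∘ ψ).2 = 0}` and `a = (T (dψ_p v)).2 ≠ 0` (the velocity
`v` is transversal to the slice): for small `t > 0` the chart-straight curve `c` through `p` with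
velocity `v` lies in `O` with `a · (T (ψ (c t))).2 > 0`, and for small `t < 0` it lies in `O`
with `a · (T (ψ (c t))).2 < 0`. [folklore] -/
theorem eventually_sliceHeight_curveThrough
    {ψ : OpenPartialHomeomorph X E3} (hψ : ψ ∈ IsManifold.maximalAtlas (𝓡 3) ∞ X)
    (T : E3 ≃L[ℝ] EuclideanSpace ℝ (Fin 2) × ℝ) {O : Set X} (hO : IsOpen O) (hOψ : O ⊆ ψ.source)
    {p : X} (hpO : p ∈ O) (hp0 : (T (ψ p)).2 = 0) {v : TangentSpace (𝓡 3) p}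
    (ha : (T (mfderiv (𝓡 3) (𝓡 3) ψ p v)).2 ≠ 0) :
    (∀ᶠ t in 𝓝[>] (0 : ℝ), curveThrough (𝓡 3) p v t ∈ O ∧
      0 < (T (mfderiv (𝓡 3) (𝓡 3) ψ p v)).2 * (T (ψ (curveThrough (𝓡 3) p v t))).2) ∧
    (∀ᶠ t in 𝓝[<] (0 : ℝ), curveThrough (𝓡 3) p v t ∈ O ∧
      (T (mfderiv (𝓡 3) (𝓡 3) ψ p v)).2 * (T (ψ (curveThrough (𝓡 3) p v t))).2 < 0) := by
  have hder := hasDerivAt_sliceHeight_curveThrough hψ T (hOψ hpO) v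
  have h0 : (fun t ↦ (T (ψ (curveThrough (𝓡 3) p v t))).2) 0 = 0 := by
    simp only [curveThrough_zero]; exact hp0
  obtain ⟨hpos, hneg⟩ := eventually_mul_pos_and_mul_neg_of_hasDerivAt hder h0 ha
  have hO' : ∀ᶠ t in 𝓝 (0 : ℝ), curveThrough (𝓡 3) p v t ∈ O := by
    refine (hasMFDerivAt_curveThrough_zero (I := 𝓡 3) BoundarylessManifold.isInteriorPoint
      v).continuousAt.preimage_mem_nhds ?_
    rw [curveThrough_zero]
    exact hO.mem_nhds hpO
  exact ⟨(hO'.filter_mono nhdsWithin_le_nhds).and hpos,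
    (hO'.filter_mono nhdsWithin_le_nhds).and hneg⟩

end CurveThrough

/-! ### A unit normal of a hypersurface is transversal to its slice charts -/

section Normal

variable {X : Type*} [TopologicalSpace X] [ChartedSpace E3 X] [IsManifold (𝓡 3) ∞ X]
  {h : ContMDiffRiemannianMetric (𝓡 3) ∞ E3 (TangentSpace (𝓡 3) : X → Type _)}
  {S : Type*} [TopologicalSpace S] [ChartedSpace (EuclideanSpace ℝ (Fin 2)) S]
  {f : S → X} {ν : NormalField (𝓡 3) f}

/-- **A unit normal is not tangent to the slice.** Let `f : S → X` be a spacelike immersion of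
a surface into the Riemannian `3`-manifold `(X, h)` with unit normal `ν` (`h(ν, ν) = 1`,
`ν ⊥ df`), and let `ψ`, `T`, `O` be a chart of the maximal atlas, a linear straightening and an
open subset of `ψ.source` in which `f` takes values in the slice `{(T ∘ ψ).2 = 0}`. Then at every
`y` with `f y ∈ O` the normal is transversal to the slice: `(T (dψ (ν y))).2 ≠ 0`. (The height
`(T ∘ ψ).2 ∘ f` vanishes near `y`, so its differential `((T ∘ dψ).2) ∘ df_y` vanishes; `df_y` is
injective and `ν y ∉ range df_y` since `h(ν, df w) = 0 ≠ 1 = h(ν, ν)`, so `range df_y ⊕ ℝ ν y`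
is all of `T_{f y} X` by a dimension count, and the covector `(T ∘ dψ).2`, non-zero as `dψ` is an
isomorphism, cannot vanish on it.) The linear algebra of Lee 2013, Thm. 5.8 (the tangent space of
a slice). [cite: LeeSmoothManifolds2013, Thm. 5.8 and Prop. 5.2] -/
theorem snd_straighten_mfderiv_normal_ne_zero
    (hf : (ofRiemannian h).IsSpacelikeImmersion (𝓡 2) f)
    (hν : (ofRiemannian h).IsUnitNormal (𝓡 2) f ν 1)
    {ψ : OpenPartialHomeomorph X E3} (hψ : ψ ∈ IsManifold.maximalAtlas (𝓡 3) ∞ X)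
    (T : E3 ≃L[ℝ] EuclideanSpace ℝ (Fin 2) × ℝ) {O : Set X} (hO : IsOpen O) (hOψ : O ⊆ ψ.source)
    (hslice : ∀ z, f z ∈ O → (T (ψ (f z))).2 = 0) {y : S} (hy : f y ∈ O) :
    (T (mfderiv (𝓡 3) (𝓡 3) ψ (f y) (ν y))).2 ≠ 0 := by
  have hp : f y ∈ ψ.source := hOψ hy
  have hψd : ψ.MDifferentiable (𝓡 3) (𝓡 3) :=
    ⟨(contMDiffOn_of_mem_maximalAtlas hψ).mdifferentiableOn (by simp),
      (contMDiffOn_symm_of_mem_maximalAtlas hψ).mdifferentiableOn (by simp)⟩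
  -- the differential of the chart as an isomorphism, and the covector `μ = (T ∘ dψ).2`
  set L : TangentSpace (𝓡 3) (f y) ≃L[ℝ] TangentSpace (𝓡 3) (ψ (f y)) := hψd.mfderiv hp
    with hLdef
  set Λ : E3 →L[ℝ] ℝ :=
    (ContinuousLinearMap.snd ℝ (EuclideanSpace ℝ (Fin 2)) ℝ).comp (T : E3 →L[ℝ] _) with hΛ
  have hΛapply : ∀ u : E3, Λ u = (T u).2 := fun u ↦ rfl
  set μ : TangentSpace (𝓡 3) (f y) →L[ℝ] ℝ :=
    Λ.comp (L : TangentSpace (𝓡 3) (f y) →L[ℝ] TangentSpace (𝓡 3) (ψ (f y))) with hμ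
  have hμapply : ∀ w, μ w = (T (mfderiv (𝓡 3) (𝓡 3) ψ (f y) w)).2 := fun w ↦ rfl
  -- (i) `μ ∘ df_y = 0`: the height vanishes along `f` near `y`
  have hfc : ContMDiff (𝓡 2) (𝓡 3) ∞ f := hf.contMDiff_self
  have hdf : HasMFDerivAt (𝓡 2) (𝓡 3) f y (mfderiv (𝓡 2) (𝓡 3) f y) :=
    (hfc.mdifferentiableAt (by simp)).hasMFDerivAt
  have hμdf : ∀ w : TangentSpace (𝓡 2) y, μ (mfderiv (𝓡 2) (𝓡 3) f y w) = 0 := by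
    have hev : (((Λ : E3 → ℝ) ∘ ψ) ∘ f) =ᶠ[𝓝 y] fun _ ↦ (0 : ℝ) := by
      filter_upwards [(hO.preimage hfc.continuous).mem_nhds hy] with z hz
      exact hslice z hz
    have h1 : HasMFDerivAt (𝓡 2) 𝓘(ℝ, ℝ) (((Λ : E3 → ℝ) ∘ ψ) ∘ f) y
        ((Λ.comp (mfderiv (𝓡 3) (𝓡 3) ψ (f y))).comp (mfderiv (𝓡 2) (𝓡 3) f y)) :=
      ((Λ.hasMFDerivAt).comp (f y) (hψd.mdifferentiableAt hp).hasMFDerivAt).comp y hdf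
    have h2 : HasMFDerivAt (𝓡 2) 𝓘(ℝ, ℝ) (((Λ : E3 → ℝ) ∘ ψ) ∘ f) y
        (0 : TangentSpace (𝓡 2) y →L[ℝ] TangentSpace 𝓘(ℝ, ℝ) ((((Λ : E3 → ℝ) ∘ ψ) ∘ f) y)) :=
      (hasMFDerivAt_const (I := 𝓡 2) (I' := 𝓘(ℝ, ℝ)) (0 : ℝ) y).congr_of_eventuallyEq hev
    intro w
    exact DFunLike.congr_fun (hasMFDerivAt_unique h1 h2) w
  -- (ii) `ν y ∉ range df_y` and `ν y ≠ 0`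
  haveI : FiniteDimensional ℝ (TangentSpace (𝓡 3) (f y)) :=
    inferInstanceAs (FiniteDimensional ℝ E3)
  set Rg : Submodule ℝ (TangentSpace (𝓡 3) (f y)) := LinearMap.range
    (mfderiv (𝓡 2) (𝓡 3) f y : TangentSpace (𝓡 2) y →ₗ[ℝ] TangentSpace (𝓡 3) (f y)) with hRg
  have hRg2 : Module.finrank ℝ Rg = 2 := by
    rw [hRg, LinearMap.finrank_range_of_inj]
    · exact finrank_euclideanSpace_fin
    · exact hf.injective_mfderiv y
  have hνR : ν y ∉ Rg := by
    rintro ⟨w, hw⟩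
    have h1 := hν.1 y w
    have hw' : mfderiv (𝓡 2) (𝓡 3) f y w = ν y := hw
    rw [hw', hν.2 y] at h1
    exact one_ne_zero h1
  have hν0 : ν y ≠ 0 := by
    intro h0
    have h2 := hν.2 y
    simp [h0] at h2
  -- (iii) `range df_y ⊔ ℝ ν y = T_{f y} X` by the dimension count `2 + 1 = 3`
  have hsup : Rg ⊔ (ℝ ∙ ν y) = ⊤ := by
    apply Submodule.eq_top_of_finrank_eq
    have key := Submodule.finrank_sup_add_finrank_inf_eq Rg (ℝ ∙ ν y)
    rw [disjoint_iff.mp (Submodule.disjoint_span_singleton_of_notMem hνR), finrank_bot, add_zero,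
      hRg2, finrank_span_singleton hν0] at key
    rw [key]
    exact (finrank_euclideanSpace_fin (𝕜 := ℝ) (n := 3)).symm
  -- (iv) if `μ (ν y) = 0` then `μ = 0`; but `μ` takes the value `1`
  intro hzero
  have hker : LinearMap.ker (μ : TangentSpace (𝓡 3) (f y) →ₗ[ℝ] ℝ) = ⊤ := by
    rw [eq_top_iff, ← hsup, sup_le_iff]
    constructor
    · rintro _ ⟨w, rfl⟩
      exact hμdf w
    · rw [Submodule.span_singleton_le_iff_mem]
      show μ (ν y) = 0
      rw [hμapply]; exact hzero
  have hμ0 : (μ : TangentSpace (𝓡 3) (f y) →ₗ[ℝ] ℝ) = 0 := LinearMap.ker_eq_top.mp hker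
  have hone : μ (L.symm (T.symm (0, 1))) = 1 := by
    show Λ (L (L.symm (T.symm (0, 1)))) = 1
    rw [L.apply_symm_apply, hΛapply]
    show (T (T.symm (0, 1))).2 = 1
    rw [T.apply_symm_apply]
  have hzero' : μ (L.symm (T.symm (0, 1))) = 0 := by
    show (μ : TangentSpace (𝓡 3) (f y) →ₗ[ℝ] ℝ) (L.symm (T.symm (0, 1))) = 0
    rw [hμ0]; rfl
  rw [hone] at hzero'
  exact one_ne_zero hzero'

end Normal

/-! ### Sides of an open set along a curve crossing its boundary -/

section Sides

variable {X : Type*} [TopologicalSpace X]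

/-- A preconnected set which misses the topological boundary of the open set `U` and meets `U`
lies in `U` (its points in `closure U ∖ U = frontier U` are excluded). The step "each open
half-box lies in `U` or misses it" of Huisken–Ilmanen 2001, §4, as in
`minimalSurface_boundary_maximumPrinciple_of_barrierPrinciple`. [folklore] -/
theorem subset_of_isPreconnected_of_disjoint_frontier {U H : Set X} (hU : IsOpen U)
    (hH : IsPreconnected H) (hHF : Disjoint H (frontier U)) (hne : (H ∩ U).Nonempty) : H ⊆ U := by
  refine hH.subset_of_closure_inter_subset hU hne ?_
  rintro x ⟨hxU, hxH⟩
  by_contra hx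
  have hfr : x ∈ frontier U := ⟨hxU, by rwa [hU.interior_eq]⟩
  exact Set.disjoint_left.mp hHF hxH hfr

/-- An open preconnected set which misses the topological boundary of the open set `U` and is
not contained in `U` misses `closure U`. [folklore] -/
theorem disjoint_closure_of_isPreconnected_of_not_subset {U H : Set X} (hU : IsOpen U)
    (hHo : IsOpen H) (hH : IsPreconnected H) (hHF : Disjoint H (frontier U)) (hns : ¬ H ⊆ U) :
    Disjoint H (closure U) := by
  have hd : Disjoint H U := by
    rw [Set.disjoint_iff_inter_eq_empty]
    by_contra hne
    exact hns (subset_of_isPreconnected_of_disjoint_frontier hU hH hHF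
      (Set.nonempty_iff_ne_empty.mpr hne))
  exact hd.closure_right hHo

/-- **Two-sided / one-sided bookkeeping along a curve crossing `∂U`.** Let `U` be open and let
`Hν`, `Hₒ` be preconnected sets missing `frontier U`, `Hₒ` open; let `c : ℝ → X` be a curve with
`c t ∈ Hν` for small `t > 0`, `c t ∈ Hₒ` for small `t < 0`, and `c t ∈ U` for small `t > 0`.
Then `Hν ⊆ U`; `c t ∈ U` for small `t < 0` iff `Hₒ ⊆ U`; and `c t ∉ closure U` for small `t < 0`
iff `Hₒ ⊄ U`. [folklore] -/
theorem sides_of_eventually_mem {U : Set X} (hU : IsOpen U) {Hν Ho : Set X}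
    (hνc : IsPreconnected Hν) (hoc : IsPreconnected Ho) (hoo : IsOpen Ho)
    (hνF : Disjoint Hν (frontier U)) (hoF : Disjoint Ho (frontier U))
    {c : ℝ → X} (hpos : ∀ᶠ t in 𝓝[>] (0 : ℝ), c t ∈ Hν) (hneg : ∀ᶠ t in 𝓝[<] (0 : ℝ), c t ∈ Ho)
    (hinto : ∀ᶠ t in 𝓝[>] (0 : ℝ), c t ∈ U) :
    Hν ⊆ U ∧ ((∀ᶠ t in 𝓝[<] (0 : ℝ), c t ∈ U) ↔ Ho ⊆ U) ∧
      ((∀ᶠ t in 𝓝[<] (0 : ℝ), c t ∉ closure U) ↔ ¬ Ho ⊆ U) := by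
  have hνU : Hν ⊆ U := by
    obtain ⟨t, ht1, ht2⟩ := (hpos.and hinto).exists
    exact subset_of_isPreconnected_of_disjoint_frontier hU hνc hνF ⟨c t, ht1, ht2⟩
  refine ⟨hνU, ⟨fun hev ↦ ?_, fun ho ↦ hneg.mono fun t ht ↦ ho ht⟩,
    ⟨fun hev ho ↦ ?_, fun ho ↦ ?_⟩⟩
  · obtain ⟨t, ht1, ht2⟩ := (hneg.and hev).exists
    exact subset_of_isPreconnected_of_disjoint_frontier hU hoc hoF ⟨c t, ht1, ht2⟩
  · obtain ⟨t, ht1, ht2⟩ := (hneg.and hev).exists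
    exact ht2 (subset_closure (ho ht1))
  · have hd := disjoint_closure_of_isPreconnected_of_not_subset hU hoo hoc hoF ho
    exact hneg.mono fun t ht hct ↦ Set.disjoint_left.mp hd ht hct

end Sides

/-! ### The sides of a compact minimal boundary -/

section Boundary

variable {X : Type*} [TopologicalSpace X] [ChartedSpace E3 X] [IsManifold (𝓡 3) ∞ X]
  {h : ContMDiffRiemannianMetric (𝓡 3) ∞ E3 (TangentSpace (𝓡 3) : X → Type _)}
  [(ofRiemannian h).HasLeviCivita] {U : Opens X}

namespace MinimalBoundary

/-- **The sides of `U` in a slice box of its boundary.** Let `U` be open with compact minimal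
boundary `∂U = range B.f` (`MinimalBoundary`: embedded, with a unit normal `B.ν` along which the
chart-straight curves `c_y` enter `U` for small `t > 0`), and let `(ψ, T, O)` be a slice box of
the embedded surface `range B.f` (`exists_sliceBox`: `range B.f ∩ O` is the slice
`{(T ∘ ψ).2 = 0}` of the open `O ⊆ ψ.source`, with preconnected open half-boxes `H₊ = {> 0}`,
`H₋ = {< 0}`). Then for every `y` with `B.f y ∈ O`: one of the half-boxes (the one `c_y` enters
for small `t > 0`, by transversality of the normal, `snd_straighten_mfderiv_normal_ne_zero` and
`eventually_sliceHeight_curveThrough`) lies in `U`; `c_y t ∈ U` for small `t < 0` (`U` lies on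
both sides of `∂U` at `B.f y`) iff **both** half-boxes lie in `U`; and `c_y t ∉ closure U` for
small `t < 0` (`U` lies on one side, the clause of `IsOutsideOf`) iff **not both** do. In
particular the side structure is the same at all points of `∂U ∩ O`. The topological half of
the argument is that of Huisken–Ilmanen 2001, §4 (proof of Lemma 4.1) as formalised in
`minimalSurface_boundary_maximumPrinciple_of_barrierPrinciple`.
[cite: HuiskenIlmanenIMCF2001, §4, proof of Lemma 4.1]
[cite: LeeSmoothManifolds2013, Thm. 5.8 and Prop. 5.2] -/
theorem sides_sliceBox (B : MinimalBoundary h (U : Set X))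
    {ψ : OpenPartialHomeomorph X E3} (hψ : ψ ∈ IsManifold.maximalAtlas (𝓡 3) ∞ X)
    (T : E3 ≃L[ℝ] EuclideanSpace ℝ (Fin 2) × ℝ) {O : Set X} (hO : IsOpen O) (hOψ : O ⊆ ψ.source)
    (hplane : range B.f ∩ O = {x | x ∈ O ∧ (T (ψ x)).2 = 0})
    (hconnp : IsPreconnected {x | x ∈ O ∧ 0 < (T (ψ x)).2})
    (hconnm : IsPreconnected {x | x ∈ O ∧ (T (ψ x)).2 < 0})
    {y : B.surf} (hy : B.f y ∈ O) :
    ({x | x ∈ O ∧ 0 < (T (ψ x)).2} ⊆ U ∨ {x | x ∈ O ∧ (T (ψ x)).2 < 0} ⊆ U) ∧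
    ((∀ᶠ t in 𝓝[<] (0 : ℝ), curveThrough (𝓡 3) (B.f y) (B.ν y) t ∈ (U : Set X)) ↔
      ({x | x ∈ O ∧ 0 < (T (ψ x)).2} ⊆ U ∧ {x | x ∈ O ∧ (T (ψ x)).2 < 0} ⊆ U)) ∧
    ((∀ᶠ t in 𝓝[<] (0 : ℝ), curveThrough (𝓡 3) (B.f y) (B.ν y) t ∉ closure (U : Set X)) ↔
      ¬ ({x | x ∈ O ∧ 0 < (T (ψ x)).2} ⊆ U ∧ {x | x ∈ O ∧ (T (ψ x)).2 < 0} ⊆ U)) := by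
  set Hp : Set X := {x | x ∈ O ∧ 0 < (T (ψ x)).2} with hHp
  set Hm : Set X := {x | x ∈ O ∧ (T (ψ x)).2 < 0} with hHm
  -- both half-boxes are open and miss `∂U = range B.f`
  have hcont : ContinuousOn (fun x ↦ (T (ψ x)).2) O :=
    (continuous_snd.comp T.continuous).comp_continuousOn (ψ.continuousOn.mono hOψ)
  have hHpo : IsOpen Hp := hcont.isOpen_inter_preimage hO isOpen_Ioi
  have hHmo : IsOpen Hm := hcont.isOpen_inter_preimage hO isOpen_Iio
  have hdisj : ∀ H : Set X, H ⊆ O → (∀ x ∈ H, (T (ψ x)).2 ≠ 0) →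
      Disjoint H (frontier (U : Set X)) := by
    intro H hHO hH0
    rw [B.frontier_eq, Set.disjoint_left]
    intro x hxH hxf
    have hx : x ∈ range B.f ∩ O := ⟨hxf, hHO hxH⟩
    rw [hplane] at hx
    exact hH0 x hxH hx.2
  have hpF := hdisj Hp (fun x hx ↦ hx.1) (fun x hx ↦ ne_of_gt hx.2)
  have hmF := hdisj Hm (fun x hx ↦ hx.1) (fun x hx ↦ ne_of_lt hx.2)
  -- the normal curve `c_y` is transversal to the slice
  have hslice : ∀ z, B.f z ∈ O → (T (ψ (B.f z))).2 = 0 := fun z hz ↦ by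
    have hz' : B.f z ∈ range B.f ∩ O := ⟨mem_range_self z, hz⟩
    rw [hplane] at hz'
    exact hz'.2
  have ha := snd_straighten_mfderiv_normal_ne_zero B.isSpacelikeImmersion B.isUnitNormal hψ T hO
    hOψ hslice hy
  obtain ⟨hpos, hneg⟩ := eventually_sliceHeight_curveThrough hψ T hO hOψ hy (hslice y hy) ha
  rcases lt_or_gt_of_ne ha with hneg' | hpos'
  · -- `a < 0`: `c_y` enters `Hm` and leaves through `Hp`
    have hpos1 : ∀ᶠ t in 𝓝[>] (0 : ℝ), curveThrough (𝓡 3) (B.f y) (B.ν y) t ∈ Hm :=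
      hpos.mono fun t ht ↦ ⟨ht.1, neg_of_mul_pos_right ht.2 hneg'.le⟩
    have hneg1 : ∀ᶠ t in 𝓝[<] (0 : ℝ), curveThrough (𝓡 3) (B.f y) (B.ν y) t ∈ Hp :=
      hneg.mono fun t ht ↦ ⟨ht.1, pos_of_mul_neg_right ht.2 hneg'.le⟩
    obtain ⟨h1, h2, h3⟩ := sides_of_eventually_mem U.isOpen hconnm hconnp hHpo hmF hpF hpos1
      hneg1 (B.pointsInto y)
    refine ⟨Or.inr h1, ?_, ?_⟩
    · rw [h2]; exact ⟨fun hp ↦ ⟨hp, h1⟩, fun hb ↦ hb.1⟩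
    · rw [h3]; exact not_congr ⟨fun hp ↦ ⟨hp, h1⟩, fun hb ↦ hb.1⟩
  · -- `a > 0`: `c_y` enters `Hp` and leaves through `Hm`
    have hpos1 : ∀ᶠ t in 𝓝[>] (0 : ℝ), curveThrough (𝓡 3) (B.f y) (B.ν y) t ∈ Hp :=
      hpos.mono fun t ht ↦ ⟨ht.1, pos_of_mul_pos_right ht.2 hpos'.le⟩
    have hneg1 : ∀ᶠ t in 𝓝[<] (0 : ℝ), curveThrough (𝓡 3) (B.f y) (B.ν y) t ∈ Hm :=
      hneg.mono fun t ht ↦ ⟨ht.1, neg_of_mul_neg_right ht.2 hpos'.le⟩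
    obtain ⟨h1, h2, h3⟩ := sides_of_eventually_mem U.isOpen hconnp hconnm hHmo hpF hmF hpos1
      hneg1 (B.pointsInto y)
    refine ⟨Or.inl h1, ?_, ?_⟩
    · rw [h2]; exact ⟨fun hm ↦ ⟨h1, hm⟩, fun hb ↦ hb.2⟩
    · rw [h3]; exact not_congr ⟨fun hm ↦ ⟨h1, hm⟩, fun hb ↦ hb.2⟩

/-- **At each point the region lies on one side or on both sides of its minimal boundary.**
For `y : B.surf`, either the chart-straight normal curve `c_y` (velocity `B.ν y`, entering `U`
for small `t > 0`) lies in `U` also for small `t < 0` — `U` lies on both sides of `∂U` at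
`B.f y`, the configuration doubled by the metric completion of Huisken–Ilmanen's Lemma 4.1 —
or it lies outside `closure U` for small `t < 0`, the clause of `IsOutsideOf`
(`MassCapacity.lean`; Bray 2001, Def. 3: a surface of class `𝒮` has an inside and an outside).
[cite: HuiskenIlmanenIMCF2001, §4, Lemma 4.1] [cite: BrayRPI2001, §2 Def. 3] -/
theorem eventually_mem_or_eventually_notMem_closure (B : MinimalBoundary h (U : Set X))
    (y : B.surf) :
    (∀ᶠ t in 𝓝[<] (0 : ℝ), curveThrough (𝓡 3) (B.f y) (B.ν y) t ∈ (U : Set X)) ∨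
    (∀ᶠ t in 𝓝[<] (0 : ℝ), curveThrough (𝓡 3) (B.f y) (B.ν y) t ∉ closure (U : Set X)) := by
  obtain ⟨ψ, T, O, hψ, hO, hpO, hOψ, hplane, hconnp, hconnm, -, -⟩ :=
    exists_sliceBox B.isEmbedding y
  obtain ⟨-, h1, h2⟩ := B.sides_sliceBox hψ T hO hOψ hplane hconnp hconnm hpO
  by_cases hb : ({x | x ∈ O ∧ 0 < (T (ψ x)).2} ⊆ U ∧ {x | x ∈ O ∧ (T (ψ x)).2 < 0} ⊆ U)
  · exact Or.inl (h1.mpr hb)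
  · exact Or.inr (h2.mpr hb)

/-- The one-sidedness clause of `IsOutsideOf` at `y` holds as soon as `U` is not two-sided at
`B.f y`. [folklore] -/
theorem eventually_notMem_closure_of_not_eventually_mem (B : MinimalBoundary h (U : Set X))
    {y : B.surf}
    (hy : ¬ ∀ᶠ t in 𝓝[<] (0 : ℝ), curveThrough (𝓡 3) (B.f y) (B.ν y) t ∈ (U : Set X)) :
    ∀ᶠ t in 𝓝[<] (0 : ℝ), curveThrough (𝓡 3) (B.f y) (B.ν y) t ∉ closure (U : Set X) :=
  (B.eventually_mem_or_eventually_notMem_closure y).resolve_left hy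

/-- Conversely, the two alternatives exclude each other. [folklore] -/
theorem not_eventually_mem_of_eventually_notMem_closure (B : MinimalBoundary h (U : Set X))
    {y : B.surf}
    (hy : ∀ᶠ t in 𝓝[<] (0 : ℝ), curveThrough (𝓡 3) (B.f y) (B.ν y) t ∉ closure (U : Set X)) :
    ¬ ∀ᶠ t in 𝓝[<] (0 : ℝ), curveThrough (𝓡 3) (B.f y) (B.ν y) t ∈ (U : Set X) := by
  intro h2
  obtain ⟨t, ht1, ht2⟩ := (hy.and h2).exists
  exact ht1 (subset_closure ht2)

/-- **Two-sidedness is all-or-nothing along each component of the boundary.** The set of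
`y : B.surf` at which `U` lies on both sides of `∂U` is open and closed in `B.surf` (it is
locally constant: inside a slice box it is read off from the two half-boxes,
`sides_sliceBox`), hence a union of connected components: a component of `∂U` is either
*doubled* (interior to `closure U`; two boundary components of the metric completion `M'` of
`U`, Huisken–Ilmanen 2001, Lemma 4.1) or bounds `U` on the side of `B.ν` only.
[cite: HuiskenIlmanenIMCF2001, §4, Lemma 4.1] -/
theorem isClopen_setOf_eventually_mem (B : MinimalBoundary h (U : Set X)) :
    IsClopen {y : B.surf |
      ∀ᶠ t in 𝓝[<] (0 : ℝ), curveThrough (𝓡 3) (B.f y) (B.ν y) t ∈ (U : Set X)} := by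
  -- local constancy in slice boxes
  have key : ∀ y₀ : B.surf, ∃ V ∈ 𝓝 y₀, ∀ y ∈ V,
      ((∀ᶠ t in 𝓝[<] (0 : ℝ), curveThrough (𝓡 3) (B.f y) (B.ν y) t ∈ (U : Set X)) ↔
        ∀ᶠ t in 𝓝[<] (0 : ℝ), curveThrough (𝓡 3) (B.f y₀) (B.ν y₀) t ∈ (U : Set X)) := by
    intro y₀
    obtain ⟨ψ, T, O, hψ, hO, hpO, hOψ, hplane, hconnp, hconnm, -, -⟩ :=
      exists_sliceBox B.isEmbedding y₀
    refine ⟨B.f ⁻¹' O, (hO.preimage B.isEmbedding.isEmbedding.continuous).mem_nhds hpO,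
      fun y hy ↦ ?_⟩
    rw [(B.sides_sliceBox hψ T hO hOψ hplane hconnp hconnm hy).2.1,
      (B.sides_sliceBox hψ T hO hOψ hplane hconnp hconnm hpO).2.1]
  constructor
  · rw [← isOpen_compl_iff, isOpen_iff_mem_nhds]
    intro y₀ hy₀
    obtain ⟨V, hV, hVc⟩ := key y₀
    filter_upwards [hV] with y hy
    exact fun h2 ↦ hy₀ ((hVc y hy).mp h2)
  · rw [isOpen_iff_mem_nhds]
    intro y₀ hy₀
    obtain ⟨V, hV, hVc⟩ := key y₀
    filter_upwards [hV] with y hy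
    exact (hVc y hy).mpr hy₀

end MinimalBoundary

end Boundary

end Literature.Geometry.Lorentzian

end
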